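import Literature.Computability.AlgebraicComplexity.BDI20SemistandardHwvTableau
import Literature.Computability.AlgebraicComplexity.BDI20CrossbarRelationalGrid
import Literature.Computability.Complexity.CodeFPOrderKit
import Literature.Computability.Complexity.CodeFPLists
import HarnessLib

/-!
# Bläser–Dörfler–Ikenmeyer 2020, §8 (CCC 2021 Lemmas 8.4, 8.7, Thm 8.9): the maps of the
# hardness reduction ON CODES — Lemma 25's column lists, Thm 30's tableau, and the crossbar's data

M. Bläser, J. Dörfler, C. Ikenmeyer, *On the complexity of evaluating highest weight vectors*,
arXiv:2002.11594 (= CCC 2021, LIPIcs 200:29), §8. Cell `val-lit`, seat x6 g8 (closer-owner of the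
§8 programme, lead-np RULINGS (124)/(125); file "F-maps" of `HOME/np/NOTE-x6g8-BDI20-sec8-LAYOUT.md`).
The printed reductions (Lemma 28 → Lemma 29 → Lemma 25 → Thm 30) are "polynomial-time" by
inspection in print; the tree's Karp framework (`IsNPHard`, `≤ₚ`) and ETH transfer
(`BDI20HwvETHTransfer`) need the maps as `CodeFP` programs (typed polynomial-time algebra,
`Complexity/CodeFP*.lean`). This file supplies the D-INDEPENDENT code-level bricks (FILE D,
Lemma 29's 8-regularisation, is t20's and pending):

* `GridCols.*` — **Lemma 25 on codes**: ℕ-indexed mirrors `keyLTB`, `labelN`, `isInterB`,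
  `isIntraB`, `colN`, `rawInterN`, `rawIntraN`, `interColsN`, `intraColsN` of FILE A's
  `GridLikeLayered.label / rawInter / interCols / …`, the bridge `interColsN_eq`, `intraColsN_eq`
  (`interColsN n (posOf G) (multOf G) = G.interCols` for every `G : GridLikeLayered n`), and
  ★ `GridCols.interColsFP`, `GridCols.intraColsFP`: `CodeFP` programs for `T̂_↕`, `T̂_↔` from
  ANY vertex count (binary, with a unary budget), position function and multiplicity function given
  on codes (relabelling by rank = a filtered count, the raw columns by a double loop, the ordering
  by `insertionSortCtx`).
* `Thm30.*` — **Thm 30's tableau on codes**: ★ `Thm30.tableauFP k`, `Thm30.tableauFP_tabE k`: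
  `(T_↕, T_↔) ↦ Thm30.tableau k T_↕ T_↔` (FILE E) is `CodeFP` (output in raw list code, resp. in
  the tree's `tableauEncoding`).
* `Crossbar.*` — **the crossbar's data on codes** (FILE C′): `offFP`, `coordsFP`, `posNFP`,
  `eqTestFP`, `neTestFP`, ★ `eqBFP`, `neBFP` — positions and the two adjacency predicates of
  `Crossbar.crossbar V adj` from `V` and `adj` given on codes.

HONEST FRAMING: machine plumbing for an NP- / ETH-hardness transcription about EVALUATING highest
weight vectors; nothing here bears on `VP ≠ VNP`, which is NOT proved. No conjecture, no named
fact, no `instance`, no notation; `0` sorries. Lesson applied (x6 g7): every `CodeFP` composite is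
built bottom-up WITHOUT an expected type and re-targeted by `.congr`.

## References
* [BlaserDorflerIkenmeyer2020] arXiv:2002.11594 Lemma 25, Lemma 28, Thm 30 (= CCC 2021 Lemmas 8.4,
  8.7, Thm 8.9).
* [AroraBarak2009] S. Arora, B. Barak, *Computational Complexity*, §1.3 (polynomial time; closure
  under polynomially bounded loops) — the `CodeFP` combinators.
-/

namespace Literature.Computability.AlgebraicComplexity

namespace BDI2020

namespace GridCols

open GridLikeLayered (ColLE)

/-! ### ℕ-indexed mirrors of the relabelling and the column lists of Lemma 25 -/

/-- The layer-by-layer, left-to-right order on positions (Boolean). [cite: BlaserDorflerIkenmeyer2020, Lemma 25, proof (arXiv; = CCC 2021 Lemma 8.4)] -/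
def keyLTB (pos : ℕ → ℕ × ℕ) (w v : ℕ) : Bool :=
  decide ((pos w).2 < (pos v).2) || (decide ((pos w).2 = (pos v).2) && decide ((pos w).1 < (pos v).1))

/-- The new label of vertex `v`: the number of vertices before it in the `(layer, x)` order.
[cite: BlaserDorflerIkenmeyer2020, Lemma 25, proof (arXiv; = CCC 2021 Lemma 8.4)] -/
def labelN (n : ℕ) (pos : ℕ → ℕ × ℕ) (v : ℕ) : ℕ :=
  ((List.range n).filter fun w => keyLTB pos w v).length

/-- Edge from a layer to the next (lower end first). [cite: BlaserDorflerIkenmeyer2020, Lemma 25, proof (arXiv; = CCC 2021 Lemma 8.4)] -/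
def isInterB (pos : ℕ → ℕ × ℕ) (mult : ℕ → ℕ → ℕ) (u v : ℕ) : Bool :=
  decide (0 < mult u v) && decide ((pos v).2 = (pos u).2 + 1)

/-- Edge inside a layer (left end first). [cite: BlaserDorflerIkenmeyer2020, Lemma 25, proof (arXiv; = CCC 2021 Lemma 8.4)] -/
def isIntraB (pos : ℕ → ℕ × ℕ) (mult : ℕ → ℕ → ℕ) (u v : ℕ) : Bool :=
  decide (0 < mult u v) && (decide ((pos v).2 = (pos u).2) && decide ((pos v).1 = (pos u).1 + 1))

/-- The column `(u over v)` in the new labels. [cite: BlaserDorflerIkenmeyer2020, Lemma 25, proof (arXiv; = CCC 2021 Lemma 8.4)] -/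
def colN (n : ℕ) (pos : ℕ → ℕ × ℕ) (u v : ℕ) : List ℕ := [labelN n pos u, labelN n pos v]

/-- `T̂_↕` before ordering. [cite: BlaserDorflerIkenmeyer2020, Lemma 25, proof (arXiv; = CCC 2021 Lemma 8.4)] -/
def rawInterN (n : ℕ) (pos : ℕ → ℕ × ℕ) (mult : ℕ → ℕ → ℕ) : List (List ℕ) :=
  (List.range n).flatMap fun u => (List.range n).flatMap fun v =>
    if isInterB pos mult u v then List.replicate (mult u v) (colN n pos u v) else []

/-- `T̂_↔` before ordering. [cite: BlaserDorflerIkenmeyer2020, Lemma 25, proof (arXiv; = CCC 2021 Lemma 8.4)] -/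
def rawIntraN (n : ℕ) (pos : ℕ → ℕ × ℕ) (mult : ℕ → ℕ → ℕ) : List (List ℕ) :=
  (List.range n).flatMap fun u => (List.range n).flatMap fun v =>
    if isIntraB pos mult u v then List.replicate (mult u v) (colN n pos u v) else []

/-- `T̂_↕` (ordered). [cite: BlaserDorflerIkenmeyer2020, Lemma 25, proof (arXiv; = CCC 2021 Lemma 8.4)] -/
def interColsN (n : ℕ) (pos : ℕ → ℕ × ℕ) (mult : ℕ → ℕ → ℕ) : List (List ℕ) :=
  (rawInterN n pos mult).insertionSort ColLE

/-- `T̂_↔` (ordered). [cite: BlaserDorflerIkenmeyer2020, Lemma 25, proof (arXiv; = CCC 2021 Lemma 8.4)] -/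
def intraColsN (n : ℕ) (pos : ℕ → ℕ × ℕ) (mult : ℕ → ℕ → ℕ) : List (List ℕ) :=
  (rawIntraN n pos mult).insertionSort ColLE

/-! ### The bridge to `GridLikeLayered.interCols / intraCols` -/

section Bridge

variable {n : ℕ} (G : GridLikeLayered n)

/-- The positions of `G` as a total function on `ℕ`. [cite: BlaserDorflerIkenmeyer2020, Def. 24 (arXiv; = CCC 2021 Def. 8.3)] -/
def posOf (v : ℕ) : ℕ × ℕ := if h : v < n then G.pos ⟨v, h⟩ else (0, 0)

/-- The multiplicities of `G` as a total function on `ℕ`. [cite: BlaserDorflerIkenmeyer2020, Def. 24 (arXiv; = CCC 2021 Def. 8.3)] -/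
def multOf (u v : ℕ) : ℕ :=
  if hu : u < n then (if hv : v < n then G.mult ⟨u, hu⟩ ⟨v, hv⟩ else 0) else 0

/-- `posOf` on a vertex. [folklore] -/
private theorem posOf_val (v : Fin n) : posOf G v.val = G.pos v := by simp [posOf, v.2]

/-- `multOf` on vertices. [folklore] -/
private theorem multOf_val (u v : Fin n) : multOf G u.val v.val = G.mult u v := by simp [multOf, u.2, v.2]

/-- The Boolean key is `KeyLT`. [cite: BlaserDorflerIkenmeyer2020, Lemma 25, proof (arXiv; = CCC 2021 Lemma 8.4)] -/
private theorem keyLTB_iff (w v : Fin n) : keyLTB (posOf G) w.val v.val = true ↔ G.KeyLT w v := by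
  simp [keyLTB, posOf_val, GridLikeLayered.KeyLT]

/-- `flatMap` over `finRange` through the values. [folklore] -/
private theorem flatMap_range_eq {β : Type*} (f : ℕ → List β) :
    (List.range n).flatMap f = (List.finRange n).flatMap fun v => f v.val := by
  rw [← List.map_coe_finRange_eq_range, List.flatMap_map]

/-- **The ℕ-indexed label is Lemma 25's label.** [cite: BlaserDorflerIkenmeyer2020, Lemma 25, proof (arXiv; = CCC 2021 Lemma 8.4)] -/
theorem labelN_eq (v : Fin n) : labelN n (posOf G) v.val = G.label v := by
  unfold labelN GridLikeLayered.label
  rw [Finset.card_def, Finset.filter_val, Finset.val_univ_fin, Multiset.filter_coe, Multiset.coe_card,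
    ← List.map_coe_finRange_eq_range, List.filter_map, List.length_map]
  congr 1
  refine List.filter_congr fun w _ => ?_
  simp only [Function.comp_apply]
  rw [Bool.eq_iff_iff, keyLTB_iff, decide_eq_true_iff]

/-- The ℕ-indexed column is Lemma 25's column. [cite: BlaserDorflerIkenmeyer2020, Lemma 25, proof (arXiv; = CCC 2021 Lemma 8.4)] -/
theorem colN_eq (u v : Fin n) : colN n (posOf G) u.val v.val = G.col u v := by
  simp [colN, GridLikeLayered.col, labelN_eq]

/-- The Boolean inter-layer test is `IsInter`. [cite: BlaserDorflerIkenmeyer2020, Lemma 25, proof (arXiv; = CCC 2021 Lemma 8.4)] -/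
private theorem isInterB_eq (u v : Fin n) : isInterB (posOf G) (multOf G) u.val v.val = decide (G.IsInter u v) := by
  simp [isInterB, posOf_val, multOf_val, GridLikeLayered.IsInter]

/-- The Boolean intra-layer test is `IsIntra`. [cite: BlaserDorflerIkenmeyer2020, Lemma 25, proof (arXiv; = CCC 2021 Lemma 8.4)] -/
private theorem isIntraB_eq (u v : Fin n) : isIntraB (posOf G) (multOf G) u.val v.val = decide (G.IsIntra u v) := by
  simp [isIntraB, posOf_val, multOf_val, GridLikeLayered.IsIntra]

/-- **`rawInterN` is Lemma 25's raw `T̂_↕`.** [cite: BlaserDorflerIkenmeyer2020, Lemma 25, proof (arXiv; = CCC 2021 Lemma 8.4)] -/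
theorem rawInterN_eq : rawInterN n (posOf G) (multOf G) = G.rawInter := by
  unfold rawInterN GridLikeLayered.rawInter
  rw [flatMap_range_eq]
  refine List.flatMap_congr fun u _ => ?_
  rw [flatMap_range_eq]
  refine List.flatMap_congr fun v _ => ?_
  rw [isInterB_eq, multOf_val, colN_eq]
  by_cases h : G.IsInter u v <;> simp [h]

/-- **`rawIntraN` is Lemma 25's raw `T̂_↔`.** [cite: BlaserDorflerIkenmeyer2020, Lemma 25, proof (arXiv; = CCC 2021 Lemma 8.4)] -/
theorem rawIntraN_eq : rawIntraN n (posOf G) (multOf G) = G.rawIntra := by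
  unfold rawIntraN GridLikeLayered.rawIntra
  rw [flatMap_range_eq]
  refine List.flatMap_congr fun u _ => ?_
  rw [flatMap_range_eq]
  refine List.flatMap_congr fun v _ => ?_
  rw [isIntraB_eq, multOf_val, colN_eq]
  by_cases h : G.IsIntra u v <;> simp [h]

/-- **`interColsN` is `T̂_↕`.** [cite: BlaserDorflerIkenmeyer2020, Lemma 25 (arXiv; = CCC 2021 Lemma 8.4)] -/
theorem interColsN_eq : interColsN n (posOf G) (multOf G) = G.interCols := by
  unfold interColsN GridLikeLayered.interCols; rw [rawInterN_eq]

/-- **`intraColsN` is `T̂_↔`.** [cite: BlaserDorflerIkenmeyer2020, Lemma 25 (arXiv; = CCC 2021 Lemma 8.4)] -/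
theorem intraColsN_eq : intraColsN n (posOf G) (multOf G) = G.intraCols := by
  unfold intraColsN GridLikeLayered.intraCols; rw [rawIntraN_eq]

end Bridge

/-! ### The column lists on codes (typed `CodeFP` algebra) -/

section FP

open Literature.Computability.Complexity CodeFP

variable {σ : Type} {eσ : σ → List Bool} {nf Uf : σ → ℕ} {posf : σ → ℕ → ℕ × ℕ}
  {multf : σ → ℕ → ℕ → ℕ}
  (hn : CodeFP eσ natE nf) (hU : CodeFP eσ unE Uf) (hnU : ∀ s, nf s ≤ Uf s)
  (hpos : CodeFP (pairE eσ natE) (pairE natE natE) (fun q => posf q.1 q.2))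
  (hmult : CodeFP (pairE eσ (pairE natE natE)) natE (fun q => multf q.1 q.2.1 q.2.2))
  (hmultU : ∀ s u v, multf s u v ≤ Uf s)

include hn hU hnU in
/-- The vertex range on codes. [cite: AroraBarak2009, §1.3 (polynomially bounded loops)] -/
theorem rangeFP : CodeFP eσ (rawE natE) (fun s => List.range (nf s)) :=
  (rangeOf.comp (hU.pair hn)).congr fun s => by simp [min_eq_left (hnU s)]

include hpos in
/-- The order key on codes, context `((s, v), w)`. [cite: BlaserDorflerIkenmeyer2020, Lemma 25, proof (arXiv; = CCC 2021 Lemma 8.4)] -/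
theorem keyFP : CodeFP (pairE (pairE eσ natE) natE) bitE (fun c => keyLTB (posf c.1.1) c.2 c.1.2) := by
  have kw : CodeFP (pairE (pairE eσ natE) natE) (pairE natE natE) (fun c => posf c.1.1 c.2) :=
    hpos.comp ((fst _ _).fst'.pair (snd _ _))
  have kv : CodeFP (pairE (pairE eσ natE) natE) (pairE natE natE) (fun c => posf c.1.1 c.1.2) :=
    hpos.comp (fst _ _)
  exact ((natLt.comp (kw.snd'.pair kv.snd')).or
    ((natEq.comp (kw.snd'.pair kv.snd')).and (natLt.comp (kw.fst'.pair kv.fst')))).congr fun _ => rfl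

include hn hU hnU hpos in
/-- **The relabelling on codes**, context `(s, v)`. [cite: BlaserDorflerIkenmeyer2020, Lemma 25, proof (arXiv; = CCC 2021 Lemma 8.4)] -/
theorem labelFP : CodeFP (pairE eσ natE) natE (fun q => labelN (nf q.1) (posf q.1) q.2) :=
  ((natLength natE).comp ((filter (keyFP hpos)).comp
    ((CodeFP.id _).pair ((rangeFP hn hU hnU).comp (fst _ _))))).congr fun _ => rfl

include hn hU hnU hpos in
/-- The column `(u over v)` on codes, context `(s, (u, v))`. [cite: BlaserDorflerIkenmeyer2020, Lemma 25, proof (arXiv; = CCC 2021 Lemma 8.4)] -/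
theorem colFP : CodeFP (pairE eσ (pairE natE natE)) (rawE natE)
    (fun q => colN (nf q.1) (posf q.1) q.2.1 q.2.2) := by
  have hl := labelFP hn hU hnU hpos
  have pu : CodeFP (pairE eσ (pairE natE natE)) natE (fun q => q.2.1) := (snd _ _).fst'
  have pv : CodeFP (pairE eσ (pairE natE natE)) natE (fun q => q.2.2) := (snd _ _).snd'
  have hlu := hl.comp ((fst _ _).pair pu)
  have hlv := hl.comp ((fst _ _).pair pv)
  exact ((rawCons natE).comp (hlu.pair ((rawSingleton natE).comp hlv))).congr fun _ => rfl

include hpos hmult in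
/-- The inter-layer test on codes. [cite: BlaserDorflerIkenmeyer2020, Lemma 25, proof (arXiv; = CCC 2021 Lemma 8.4)] -/
theorem isInterFP : CodeFP (pairE eσ (pairE natE natE)) bitE
    (fun q => isInterB (posf q.1) (multf q.1) q.2.1 q.2.2) := by
  have pu : CodeFP (pairE eσ (pairE natE natE)) natE (fun q => q.2.1) := (snd _ _).fst'
  have pv : CodeFP (pairE eσ (pairE natE natE)) natE (fun q => q.2.2) := (snd _ _).snd'
  have hpu := hpos.comp ((fst _ _).pair pu)
  have hpv := hpos.comp ((fst _ _).pair pv)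
  have hmpos := natLt.comp ((const (pairE eσ (pairE natE natE)) 0).pair hmult)
  exact (hmpos.and (natEq.comp (hpv.snd'.pair (natAdd.comp (hpu.snd'.pair (const _ 1)))))).congr
    fun _ => rfl

include hpos hmult in
/-- The intra-layer test on codes. [cite: BlaserDorflerIkenmeyer2020, Lemma 25, proof (arXiv; = CCC 2021 Lemma 8.4)] -/
theorem isIntraFP : CodeFP (pairE eσ (pairE natE natE)) bitE
    (fun q => isIntraB (posf q.1) (multf q.1) q.2.1 q.2.2) := by
  have pu : CodeFP (pairE eσ (pairE natE natE)) natE (fun q => q.2.1) := (snd _ _).fst'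
  have pv : CodeFP (pairE eσ (pairE natE natE)) natE (fun q => q.2.2) := (snd _ _).snd'
  have hpu := hpos.comp ((fst _ _).pair pu)
  have hpv := hpos.comp ((fst _ _).pair pv)
  have hmpos := natLt.comp ((const (pairE eσ (pairE natE natE)) 0).pair hmult)
  exact (hmpos.and ((natEq.comp (hpv.snd'.pair hpu.snd')).and
    (natEq.comp (hpv.fst'.pair (natAdd.comp (hpu.fst'.pair (const _ 1))))))).congr fun _ => rfl

include hn hU hnU hpos hmult hmultU in
/-- The replicated column of an edge on codes. [cite: BlaserDorflerIkenmeyer2020, Lemma 25, proof ("k times if the edge appears with multiplicity k") (arXiv; = CCC 2021 Lemma 8.4)] -/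
theorem repColFP : CodeFP (pairE eσ (pairE natE natE)) (rawE (rawE natE))
    (fun q => List.replicate (multf q.1 q.2.1 q.2.2) (colN (nf q.1) (posf q.1) q.2.1 q.2.2)) := by
  have hmun : CodeFP (pairE eσ (pairE natE natE)) unE (fun q => multf q.1 q.2.1 q.2.2) :=
    (unOfNatMin.comp ((hU.comp (fst _ _)).pair hmult)).congr fun q => min_eq_left (hmultU _ _ _)
  exact (replicateOf (rawE natE)).comp ((colFP hn hU hnU hpos).pair hmun)

/-- A double loop over the vertex range on codes. [cite: AroraBarak2009, §1.3 (polynomially bounded loops)] -/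
theorem doubleLoopFP (hrange : CodeFP eσ (rawE natE) (fun s => List.range (nf s)))
    {item : σ → ℕ → ℕ → List (List ℕ)}
    (hitem : CodeFP (pairE eσ (pairE natE natE)) (rawE (rawE natE)) (fun q => item q.1 q.2.1 q.2.2)) :
    CodeFP eσ (rawE (rawE natE)) (fun s =>
      (List.range (nf s)).flatMap fun u => (List.range (nf s)).flatMap fun v => item s u v) := by
  have reassoc : CodeFP (pairE (pairE eσ natE) natE) (pairE eσ (pairE natE natE))
      (fun c => (c.1.1, (c.1.2, c.2))) := (fst _ _).fst'.pair ((fst _ _).snd'.pair (snd _ _))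
  have hrange' : CodeFP (pairE eσ natE) (rawE natE) (fun q => List.range (nf q.1)) := hrange.comp (fst _ _)
  have inner : CodeFP (pairE eσ natE) (rawE (rawE natE))
      (fun q => (List.range (nf q.1)).flatMap fun v => item q.1 q.2 v) :=
    ((flatten (rawE natE)).comp ((CodeFP.map (hitem.comp reassoc)).comp
      ((CodeFP.id _).pair hrange'))).congr fun q => by
        simp only [id, List.flatMap_def]
  exact ((flatten (rawE natE)).comp ((CodeFP.map inner).comp ((CodeFP.id _).pair hrange))).congr fun s => by
    simp only [id, List.flatMap_def]

/-- The column order `ColLE` on codes (context ignored). [cite: BlaserDorflerIkenmeyer2020, Lemma 25, proof ("order of the edges … from left to right") (arXiv; = CCC 2021 Lemma 8.4)] -/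
theorem colLEFP : CodeFP (pairE eσ (pairE (rawE natE) (rawE natE))) bitE
    (fun t => decide (ColLE t.2.1 t.2.2)) := by
  have g0 : CodeFP (pairE eσ (pairE (rawE natE) (rawE natE))) natE (fun t => t.2.1.getD 0 0) :=
    (rawGetD natE natE_zero).comp ((snd _ _).fst'.pair (const _ 0))
  have g1 : CodeFP (pairE eσ (pairE (rawE natE) (rawE natE))) natE (fun t => t.2.1.getD 1 0) :=
    (rawGetD natE natE_zero).comp ((snd _ _).fst'.pair (const _ 1))
  have g0' : CodeFP (pairE eσ (pairE (rawE natE) (rawE natE))) natE (fun t => t.2.2.getD 0 0) :=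
    (rawGetD natE natE_zero).comp ((snd _ _).snd'.pair (const _ 0))
  have g1' : CodeFP (pairE eσ (pairE (rawE natE) (rawE natE))) natE (fun t => t.2.2.getD 1 0) :=
    (rawGetD natE natE_zero).comp ((snd _ _).snd'.pair (const _ 1))
  exact ((natLt.comp (g0.pair g0')).or ((natEq.comp (g0.pair g0')).and (natLe.comp (g1.pair g1')))).congr
    fun t => by simp only [GridLikeLayered.ColLE, Bool.decide_or, Bool.decide_and]

include hn hU hnU hpos hmult hmultU in
/-- **`T̂_↕` on codes.** [cite: BlaserDorflerIkenmeyer2020, Lemma 25 (arXiv; = CCC 2021 Lemma 8.4)] [cite: AroraBarak2009, §1.3] -/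
theorem interColsFP : CodeFP eσ (rawE (rawE natE)) (fun s => interColsN (nf s) (posf s) (multf s)) := by
  have hraw : CodeFP eσ (rawE (rawE natE)) (fun s => rawInterN (nf s) (posf s) (multf s)) :=
    (doubleLoopFP (rangeFP hn hU hnU) ((isInterFP hpos hmult).ite (repColFP hn hU hnU hpos hmult hmultU)
      (const _ []))).congr fun _ => rfl
  exact ((insertionSortCtx (r := fun (_ : σ) (c c' : List ℕ) => ColLE c c') colLEFP).comp
    ((CodeFP.id _).pair hraw)).congr fun _ => rfl

include hn hU hnU hpos hmult hmultU in
/-- **`T̂_↔` on codes.** [cite: BlaserDorflerIkenmeyer2020, Lemma 25 (arXiv; = CCC 2021 Lemma 8.4)] [cite: AroraBarak2009, §1.3] -/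
theorem intraColsFP : CodeFP eσ (rawE (rawE natE)) (fun s => intraColsN (nf s) (posf s) (multf s)) := by
  have hraw : CodeFP eσ (rawE (rawE natE)) (fun s => rawIntraN (nf s) (posf s) (multf s)) :=
    (doubleLoopFP (rangeFP hn hU hnU) ((isIntraFP hpos hmult).ite (repColFP hn hU hnU hpos hmult hmultU)
      (const _ []))).congr fun _ => rfl
  exact ((insertionSortCtx (r := fun (_ : σ) (c c' : List ℕ) => ColLE c c') colLEFP).comp
    ((CodeFP.id _).pair hraw)).congr fun _ => rfl

end FP

end GridCols

namespace Thm30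

open Literature.Computability.Complexity CodeFP

/-- The code of a pair of column lists `(T_↕, T_↔)`. [cite: AroraBarak2009, §0.1 (codes of lists)] -/
abbrev twoE : List (List ℕ) × List (List ℕ) → List Bool := pairE (rawE (rawE natE)) (rawE (rawE natE))

section FP

variable {σ : Type} {eσ : σ → List Bool} {rf Uf : σ → ℕ} {Sf Sf' : σ → List (List ℕ)}
  (hr : CodeFP eσ natE rf) (hU : CodeFP eσ unE Uf) (hrU : ∀ s, 24 * rf s + 1 ≤ Uf s)
  (hS : CodeFP eσ (rawE (rawE natE)) Sf) (hS' : CodeFP eσ (rawE (rawE natE)) Sf')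

/-- `c₀ + c₁ · r` on codes. [cite: AroraBarak2009, §1.3] -/
private theorem affFP (c₀ c₁ : ℕ) {f : σ → ℕ} (hf : CodeFP eσ natE f) :
    CodeFP eσ natE (fun s => c₀ + c₁ * f s) :=
  (natAdd.comp ((const _ c₀).pair (natMul.comp ((const _ c₁).pair hf)))).congr fun _ => rfl

/-- A two-box column on codes. [cite: AroraBarak2009, §1.3] -/
private theorem pairColFP {f g : σ → ℕ} (hf : CodeFP eσ natE f) (hg : CodeFP eσ natE g) :
    CodeFP eσ (rawE natE) (fun s => [f s, g s]) :=
  ((rawCons natE).comp (hf.pair ((rawSingleton natE).comp hg))).congr fun _ => rfl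

/-- `aCol (t / 8)` on codes, context `(s, t)`. [cite: BlaserDorflerIkenmeyer2020, Thm 30 (proof), Fig. semitabconstr1] -/
theorem aColFP : CodeFP (pairE eσ natE) (rawE natE) (fun q => aCol (q.2 / 8)) := by
  have hi : CodeFP (pairE eσ natE) natE (fun q => q.2 / 8) :=
    (natDiv.comp ((snd _ _).pair (const _ 8))).congr fun _ => rfl
  have h0 := affFP 0 3 hi
  have h1 := affFP 1 3 hi
  have h2 := affFP 2 3 hi
  exact ((rawCons natE).comp (h0.pair (pairColFP h1 h2))).congr fun q => by
    simp only [aCol]; refine List.cons_eq_cons.2 ⟨by ring, List.cons_eq_cons.2 ⟨by ring, List.cons_eq_cons.2 ⟨by ring, rfl⟩⟩⟩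

include hr in
/-- `bCol r` on codes. [cite: BlaserDorflerIkenmeyer2020, Thm 30 (proof)] -/
theorem bColFP : CodeFP eσ (rawE natE) (fun s => bCol (rf s)) :=
  (pairColFP (affFP 0 3 hr) (affFP 1 3 hr)).congr fun s => by simp [bCol]; ring

include hr in
/-- `dCol r` on codes. [cite: BlaserDorflerIkenmeyer2020, Thm 30 (proof)] -/
theorem dColFP : CodeFP eσ (rawE natE) (fun s => dCol (rf s)) :=
  (pairColFP (affFP 2 11 hr) (affFP 3 11 hr)).congr fun s => by simp [dCol]; constructor <;> ring

include hr in
/-- `cCol r p` on codes, context `(s, p)`. [cite: BlaserDorflerIkenmeyer2020, Thm 30 (proof)] -/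
theorem cColFP : CodeFP (pairE eσ natE) (rawE natE) (fun q => cCol (rf q.1) q.2) := by
  have hr' : CodeFP (pairE eσ natE) natE (fun q => rf q.1) := (hr.comp (fst _ _)).congr fun _ => rfl
  have hp : CodeFP (pairE eσ natE) natE (fun q => q.2) := snd _ _
  have hbase : CodeFP (pairE eσ natE) natE (fun q => 3 * rf q.1 + 2 + 2 * q.2) :=
    (natAdd.comp ((affFP 2 3 hr').pair (natMul.comp ((const _ 2).pair hp)))).congr fun _ => by ring
  exact (pairColFP hbase (natAdd.comp (hbase.pair (const _ 1)))).congr fun q => by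
    simp only [cCol, cLab]; refine List.cons_eq_cons.2 ⟨by ring, List.cons_eq_cons.2 ⟨by ring, rfl⟩⟩

include hr in
/-- `lowerCol r t` on codes, context `(s, t)`. [cite: BlaserDorflerIkenmeyer2020, Thm 30 (proof), Fig. semitabconstr1] -/
theorem lowerColFP : CodeFP (pairE eσ natE) (rawE natE) (fun q => lowerCol (rf q.1) q.2) := by
  have ht0 : CodeFP (pairE eσ natE) bitE (fun q => decide (q.2 = 0)) :=
    (natEq.comp ((snd _ _).pair (const _ 0))).congr fun _ => rfl
  have hp : CodeFP (pairE eσ natE) natE (fun q => (q.2 - 1) / 2) :=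
    (natDiv.comp ((natSub.comp ((snd _ _).pair (const _ 1))).pair (const _ 2))).congr fun _ => rfl
  have hc : CodeFP (pairE eσ natE) (rawE natE) (fun q => cCol (rf q.1) ((q.2 - 1) / 2)) :=
    ((cColFP hr).comp ((fst _ _).pair hp)).congr fun _ => rfl
  have hb : CodeFP (pairE eσ natE) (rawE natE) (fun q => bCol (rf q.1)) :=
    ((bColFP hr).comp (fst _ _)).congr fun _ => rfl
  exact (ht0.ite hb hc).congr fun q => by
    unfold lowerCol
    by_cases h : q.2 = 0 <;> simp [h]

include hr hU hrU in
/-- **`T₁` (halved) on codes.** [cite: BlaserDorflerIkenmeyer2020, Thm 30 (proof), Fig. semitabconstr1] -/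
theorem part1FP : CodeFP eσ (rawE (rawE natE)) (fun s => part1 (rf s)) := by
  have hrange : CodeFP eσ (rawE natE) (fun s => List.range (8 * rf s)) :=
    (rangeOf.comp (hU.pair (affFP 0 8 hr))).congr fun s => by
      have := hrU s; simp only [zero_add]; rw [min_eq_left (by omega)]
  have hitem : CodeFP (pairE eσ natE) (rawE natE) (fun q => aCol (q.2 / 8) ++ lowerCol (rf q.1) q.2) :=
    ((rawAppend natE).comp (aColFP.pair (lowerColFP hr))).congr fun _ => rfl
  exact ((CodeFP.map hitem).comp ((CodeFP.id _).pair hrange)).congr fun _ => rfl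

include hr in
/-- **`T₂` (halved) on codes.** [cite: BlaserDorflerIkenmeyer2020, Thm 30 (proof), Fig. semitabconstr2] -/
theorem part2FP : CodeFP eσ (rawE (rawE natE)) (fun s => part2 (rf s)) :=
  ((replicateOf (rawE natE)).comp (((rawAppend natE).comp ((bColFP hr).pair (dColFP hr))).pair
    (const _ (7 : ℕ)))).congr fun _ => rfl

include hr in
/-- `shiftCol r c` on codes, context `(s, c)`. [cite: BlaserDorflerIkenmeyer2020, Thm 30 (proof)] -/
theorem shiftColFP : CodeFP (pairE eσ (rawE natE)) (rawE natE) (fun q => shiftCol (rf q.1) q.2) := by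
  have hoff : CodeFP (pairE eσ natE) natE (fun c => c.2 + (11 * rf c.1 + 4)) :=
    (natAdd.comp ((snd _ _).pair ((affFP 4 11 hr).comp (fst _ _)))).congr fun _ => by ring
  exact (CodeFP.map hoff).congr fun q => by
    unfold shiftCol eLab
    exact List.map_congr_left fun v _ => by ring

include hr hU hrU hS in
/-- **`T₃` (halved) on codes.** [cite: BlaserDorflerIkenmeyer2020, Thm 30 (proof)] -/
theorem part3FP : CodeFP eσ (rawE (rawE natE)) (fun s => part3 (rf s) (Sf s)) := by
  have hrange : CodeFP eσ (rawE natE) (fun s => List.range (24 * rf s + 1)) :=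
    (rangeOf.comp (hU.pair (natAdd.comp ((affFP 0 24 hr).pair (const _ 1))))).congr fun s => by
      have := hrU s; simp only [zero_add]; rw [min_eq_left this]
  have ht : CodeFP (pairE eσ natE) natE (fun q => q.2) := snd _ _
  have hr' : CodeFP (pairE eσ natE) natE (fun q => rf q.1) := (hr.comp (fst _ _)).congr fun _ => rfl
  have hm : CodeFP (pairE eσ natE) natE (fun q => min (q.2 / 6) (4 * rf q.1 - 1)) :=
    (natMin.comp ((natDiv.comp (ht.pair (const _ 6))).pair
      (natSub.comp ((affFP 0 4 hr').pair (const _ 1))))).congr fun _ => by simp only [zero_add]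
  have hcs : CodeFP (pairE eσ natE) (rawE natE) (fun q => csCol (rf q.1) q.2) :=
    ((cColFP hr).comp ((fst _ _).pair hm)).congr fun q => by simp only [csCol]
  have hget : CodeFP (pairE eσ natE) (rawE natE) (fun q => (Sf q.1).getD q.2 []) :=
    ((rawGetD (rawE natE) (rawE_nil natE)).comp ((hS.comp (fst _ _)).pair ht)).congr fun _ => rfl
  have hsh : CodeFP (pairE eσ natE) (rawE natE) (fun q => shiftCol (rf q.1) ((Sf q.1).getD q.2 [])) :=
    ((shiftColFP hr).comp ((fst _ _).pair hget)).congr fun _ => rfl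
  have hitem : CodeFP (pairE eσ natE) (rawE natE)
      (fun q => csCol (rf q.1) q.2 ++ shiftCol (rf q.1) ((Sf q.1).getD q.2 [])) :=
    ((rawAppend natE).comp (hcs.pair hsh)).congr fun _ => rfl
  exact ((CodeFP.map hitem).comp ((CodeFP.id _).pair hrange)).congr fun s => rfl

include hr in
/-- **`T₄` (halved) on codes.** [cite: BlaserDorflerIkenmeyer2020, Thm 30 (proof), Fig. semitabconstr2] -/
theorem part4FP : CodeFP eσ (rawE (rawE natE)) (fun s => part4 (rf s)) :=
  ((rawSingleton (rawE natE)).comp (dColFP hr)).congr fun _ => rfl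

include hr hS' in
/-- **`T₅` (halved) on codes.** [cite: BlaserDorflerIkenmeyer2020, Thm 30 (proof)] -/
theorem part5FP : CodeFP eσ (rawE (rawE natE)) (fun s => part5 (rf s) (Sf' s)) :=
  ((CodeFP.map (shiftColFP hr)).comp ((CodeFP.id _).pair hS')).congr fun _ => rfl

end FP

/-- The unary budget `|T_↕| + 25 ≥ 24 r + 1`. [cite: BlaserDorflerIkenmeyer2020, Thm 30 (proof)] -/
private theorem budgetFP : CodeFP twoE unE (fun p => p.1.length + 25) :=
  (unAdd.comp (((ulength (rawE natE)).comp (fst _ _)).pair (const _ (25 : ℕ)))).congr fun _ => rfl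

/-- `r = ⌊|T_↕|/24⌋ + 1` on codes. [cite: BlaserDorflerIkenmeyer2020, Thm 30 (proof)] -/
private theorem rOfFP : CodeFP twoE natE (fun p => rOf p.1) :=
  (natAdd.comp ((natDiv.comp (((natLength (rawE natE)).comp (fst _ _)).pair (const _ 24))).pair
    (const _ 1))).congr fun _ => rfl

/-- **The halved tableau on codes.** [cite: BlaserDorflerIkenmeyer2020, Thm 30 (proof)] [cite: AroraBarak2009, §1.3] -/
theorem halfTableauFP : CodeFP twoE (rawE (rawE natE)) (fun p => halfTableau p.1 p.2) := by
  have hrU : ∀ p : List (List ℕ) × List (List ℕ), 24 * rOf p.1 + 1 ≤ p.1.length + 25 := fun p => by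
    unfold rOf; omega
  have h1 := part1FP rOfFP budgetFP hrU
  have h2 := part2FP (eσ := twoE) rOfFP
  have h3 := part3FP rOfFP budgetFP hrU (fst _ _)
  have h4 := part4FP (eσ := twoE) rOfFP
  have h5 := part5FP (eσ := twoE) rOfFP (snd _ _)
  have happ := rawAppend (rawE natE)
  exact ((happ.comp ((happ.comp ((happ.comp ((happ.comp (h1.pair h2)).pair h3)).pair h4)).pair h5))).congr
    fun p => rfl

/-- **Thm 30's tableau `T̂` (degree `16k`) on codes**: `(T_↕, T_↔) ↦ tableau k T_↕ T_↔` is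
polynomial-time computable (typed `CodeFP`; raw list codes).
[cite: BlaserDorflerIkenmeyer2020, Thm 30 (proof: "this reduction") (arXiv; = CCC 2021 Thm 8.9)] [cite: AroraBarak2009, §1.3] -/
theorem tableauFP (k : ℕ) : CodeFP twoE (rawE (rawE natE)) (fun p => tableau k p.1 p.2) := by
  have hrep : CodeFP (pairE twoE (rawE natE)) (rawE (rawE natE)) (fun q => List.replicate (2 * k) q.2) :=
    ((replicateOf (rawE natE)).comp ((snd _ _).pair (const _ (2 * k)))).congr fun _ => rfl
  exact ((flatten (rawE natE)).comp ((CodeFP.map hrep).comp ((CodeFP.id _).pair halfTableauFP))).congr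
    fun p => by simp only [tableau, List.flatMap_def]

/-- The same with the tree's Boolean tableau encoding as output. [cite: BlaserDorflerIkenmeyer2020, Thm 30 (arXiv; = CCC 2021 Thm 8.9)] -/
theorem tableauFP_tabE (k : ℕ) :
    CodeFP twoE (tableauEncoding.encode : List (List ℕ) → List Bool) (fun p => tableau k p.1 p.2) := by
  have h := (listOfRaw (listE natE)).comp ((map₀ (listOfRaw natE)).comp (tableauFP k))
  have h' : CodeFP twoE (listE (listE natE)) (fun p => tableau k p.1 p.2) := h.congr fun p => by simp
  have henc : (tableauEncoding.encode : List (List ℕ) → List Bool) = listE (listE natE) := by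
    unfold tableauEncoding; rw [listE_eq, listE_eq, natE_eq]
  rw [henc]
  exact h' 

end Thm30

namespace Crossbar

open Literature.Computability.Complexity CodeFP

section FP

variable {σ : Type} {eσ : σ → List Bool} {Vf : σ → ℕ} {adjf : σ → ℕ → ℕ → Bool}
  (hV : CodeFP eσ natE Vf)
  (hadj : CodeFP (pairE eσ (pairE natE natE)) bitE (fun q => adjf q.1 q.2.1 q.2.2))

/-- The offset table read coordinatewise. [folklore] -/
private theorem off_eq (s : ℕ) :
    off s = ((offTable.map Prod.fst).getD s 0, (offTable.map Prod.snd).getD s 0) := by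
  unfold off
  rw [show (0 : ℕ) = Prod.fst ((0 : ℕ), (0 : ℕ)) from rfl, List.getD_map,
    show (Prod.fst ((0 : ℕ), (0 : ℕ))) = Prod.snd ((0 : ℕ), (0 : ℕ)) from rfl, List.getD_map]

/-- The local offset table on codes. [cite: BlaserDorflerIkenmeyer2020, Lemma 28, Fig. 3colgridcrossing (arXiv; = CCC 2021 Lemma 8.7)] -/
theorem offFP : CodeFP natE (pairE natE natE) off :=
  ((((rawGetD natE natE_zero).comp ((const _ (offTable.map Prod.fst)).pair (CodeFP.id natE))).pair
    ((rawGetD natE natE_zero).comp ((const _ (offTable.map Prod.snd)).pair (CodeFP.id natE))))).congr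
    fun s => by rw [off_eq]; rfl

/-- `rowOf`, `colOf`, `locOf` on codes, context `(s, v)`. [cite: BlaserDorflerIkenmeyer2020, Lemma 28, proof (arXiv; = CCC 2021 Lemma 8.7)] -/
theorem coordsFP (hV : CodeFP eσ natE Vf) :
    CodeFP (pairE eσ natE) natE (fun q => rowOf (Vf q.1) q.2) ∧
      CodeFP (pairE eσ natE) natE (fun q => colOf (Vf q.1) q.2) ∧
      CodeFP (pairE eσ natE) natE (fun q => locOf q.2) := by
  have hv : CodeFP (pairE eσ natE) natE (fun q => q.2) := snd _ _
  have hV' : CodeFP (pairE eσ natE) natE (fun q => Vf q.1) := (hV.comp (fst _ _)).congr fun _ => rfl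
  have hb : CodeFP (pairE eσ natE) natE (fun q => q.2 / 45) := (natDiv.comp (hv.pair (const _ 45))).congr fun _ => rfl
  exact ⟨(natDiv.comp (hb.pair hV')).congr fun _ => rfl, (natMod.comp (hb.pair hV')).congr fun _ => rfl,
    (natMod.comp (hv.pair (const _ 45))).congr fun _ => rfl⟩

include hV in
/-- **The crossbar's positions on codes**, context `(s, v)`. [cite: BlaserDorflerIkenmeyer2020, Lemma 28, proof (arXiv; = CCC 2021 Lemma 8.7)] -/
theorem posNFP : CodeFP (pairE eσ natE) (pairE natE natE) (fun q => posN (Vf q.1) q.2) := by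
  obtain ⟨hr, hc, hl⟩ := coordsFP (eσ := eσ) hV
  have ho := offFP.comp hl
  exact ((natAdd.comp ((natMul.comp ((const _ 8).pair hc)).pair ho.fst')).pair
    (natAdd.comp ((natMul.comp ((const _ 8).pair hr)).pair ho.snd'))).congr fun _ => rfl

/-- Membership of a pair of naturals in a fixed list, on codes. [cite: AroraBarak2009, §1.3] -/
private theorem memPairFP (L : List (ℕ × ℕ)) {f g : σ → ℕ} (hf : CodeFP eσ natE f) (hg : CodeFP eσ natE g) :
    CodeFP eσ bitE (fun s => decide ((f s, g s) ∈ L)) :=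
  ((mem (pairE_injective natE_injective natE_injective)).comp ((hf.pair hg).pair
    (const _ L))).congr fun _ => rfl

include hV in
/-- **`eqTest` on codes**, context `(s, (v, w))`. [cite: BlaserDorflerIkenmeyer2020, Lemma 28, proof (arXiv; = CCC 2021 Lemma 8.7)] -/
theorem eqTestFP : CodeFP (pairE eσ (pairE natE natE)) bitE (fun q => eqTest (Vf q.1) q.2.1 q.2.2) := by
  obtain ⟨hr, hc, hl⟩ := coordsFP (eσ := eσ) hV
  let ctx : σ × (ℕ × ℕ) → List Bool := pairE eσ (pairE natE natE)
  have qv : CodeFP ctx (pairE eσ natE) (fun q => (q.1, q.2.1)) := (fst _ _).pair (snd _ _).fst'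
  have qw : CodeFP ctx (pairE eσ natE) (fun q => (q.1, q.2.2)) := (fst _ _).pair (snd _ _).snd'
  have rv := hr.comp qv; have rw' := hr.comp qw; have cv := hc.comp qv; have cw := hc.comp qw
  have lv := hl.comp qv; have lw := hl.comp qw
  have bv : CodeFP ctx natE (fun q => q.2.1 / 45) := (natDiv.comp ((snd _ _).fst'.pair (const _ 45))).congr fun _ => rfl
  have bw : CodeFP ctx natE (fun q => q.2.2 / 45) := (natDiv.comp ((snd _ _).snd'.pair (const _ 45))).congr fun _ => rfl
  have sameBox := natEq.comp (bv.pair bw)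
  have c1 := sameBox.and (memPairFP localEq lv lw)
  have c2 := ((sameBox.and (natEq.comp (rv.pair cv))).and (natEq.comp (lv.pair (const _ 44)))).and
    (natEq.comp (lw.pair (const _ 26)))
  have c3 := (((natEq.comp (cw.pair cv)).and (natEq.comp (rw'.pair (natAdd.comp (rv.pair (const _ 1)))))).and
    (natEq.comp (lv.pair (const _ 31)))).and (natEq.comp (lw.pair (const _ 25)))
  have c4 := (((natEq.comp (rw'.pair rv)).and (natEq.comp (cw.pair (natAdd.comp (cv.pair (const _ 1)))))).and
    (natEq.comp (lv.pair (const _ 38)))).and (natEq.comp (lw.pair (const _ 32)))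
  exact (((c1.or c2).or c3).or c4).congr fun q => by
    simp only [eqTest, beq_eq_decide]

include hV hadj in
/-- **`neTest` on codes**, context `(s, (v, w))`. [cite: BlaserDorflerIkenmeyer2020, Lemma 28, proof (arXiv; = CCC 2021 Lemma 8.7)] -/
theorem neTestFP : CodeFP (pairE eσ (pairE natE natE)) bitE (fun q => neTest (Vf q.1) (adjf q.1) q.2.1 q.2.2) := by
  obtain ⟨hr, hc, hl⟩ := coordsFP (eσ := eσ) hV
  let ctx : σ × (ℕ × ℕ) → List Bool := pairE eσ (pairE natE natE)
  have qv : CodeFP ctx (pairE eσ natE) (fun q => (q.1, q.2.1)) := (fst _ _).pair (snd _ _).fst'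
  have qw : CodeFP ctx (pairE eσ natE) (fun q => (q.1, q.2.2)) := (fst _ _).pair (snd _ _).snd'
  have rv := hr.comp qv; have cv := hc.comp qv
  have lv := hl.comp qv; have lw := hl.comp qw
  have bv : CodeFP ctx natE (fun q => q.2.1 / 45) := (natDiv.comp ((snd _ _).fst'.pair (const _ 45))).congr fun _ => rfl
  have bw : CodeFP ctx natE (fun q => q.2.2 / 45) := (natDiv.comp ((snd _ _).snd'.pair (const _ 45))).congr fun _ => rfl
  have sameBox := natEq.comp (bv.pair bw)
  have ha := hadj.comp ((fst _ _).pair (rv.pair cv))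
  have c1 := sameBox.and (memPairFP localNe lv lw)
  have c2 := (((sameBox.and (natEq.comp (rv.pair cv)).not).and ha).and (natEq.comp (lv.pair (const _ 44)))).and
    (natEq.comp (lw.pair (const _ 26)))
  exact (c1.or c2).congr fun q => by
    simp only [neTest, beq_eq_decide]

include hV in
/-- **The crossbar's equality adjacency on codes.** [cite: BlaserDorflerIkenmeyer2020, Lemma 28, proof (arXiv; = CCC 2021 Lemma 8.7)] -/
theorem eqBFP : CodeFP (pairE eσ (pairE natE natE)) bitE (fun q => eqB (Vf q.1) q.2.1 q.2.2) := by
  have h := eqTestFP (eσ := eσ) hV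
  have hswap : CodeFP (pairE eσ (pairE natE natE)) (pairE eσ (pairE natE natE)) (fun q => (q.1, (q.2.2, q.2.1))) :=
    (fst _ _).pair ((snd _ _).snd'.pair (snd _ _).fst')
  exact (h.or (h.comp hswap)).congr fun _ => rfl

include hV hadj in
/-- **The crossbar's inequality adjacency on codes.** [cite: BlaserDorflerIkenmeyer2020, Lemma 28, proof (arXiv; = CCC 2021 Lemma 8.7)] -/
theorem neBFP : CodeFP (pairE eσ (pairE natE natE)) bitE (fun q => neB (Vf q.1) (adjf q.1) q.2.1 q.2.2) := by
  have h := neTestFP (eσ := eσ) hV hadj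
  have hswap : CodeFP (pairE eσ (pairE natE natE)) (pairE eσ (pairE natE natE)) (fun q => (q.1, (q.2.2, q.2.1))) :=
    (fst _ _).pair ((snd _ _).snd'.pair (snd _ _).fst')
  exact (h.or (h.comp hswap)).congr fun _ => rfl

end FP

end Crossbar

end BDI2020

end Literature.Computability.AlgebraicComplexity
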